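import Summits.Ventures.DiscreteObjects.Hadamard.PrimeOrderSummary668
import Summits.Ventures.DiscreteObjects.Hadamard.PrimeOrder29Parity

/-!
# Hadamard 668 census, family F12 — summary WITHOUT the paper step: prime orders of automorphisms of H(668) lie in
# {2, 3, 5, 7, 11, 13, 23, 37, 41, 83, 167} (kernel)

Framing: lottery ticket; floor = certified bounds/negative ranges.

Cell pub-namedobj (venture DiscreteObjects), target (H), hadamard gen 8.  `PrimeOrderSummary668` proved
`p ∈ {2, 3, 5, 7, 11, 13, 23, 29, 37, 41, 83, 167}` for the order `p` of a nontrivial signed-permutation automorphism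
`(π, κ, d, e)`, `π^p = κ^p = 1`, of a Hadamard matrix of order `668`, with `29` excluded "on paper only" by Lander's parity theorem.
`PrimeOrder29Parity.no_automorphism_29` now proves that exclusion in the kernel for the 2-(667,333,166) structure; this file
transfers it to H(668) exactly as `AutomorphismTransfer668B` did for `17, 19, 31, 47` (`29 ∤ 668` gives a fixed row and a fixed
column; normalise there; both halves of the design identities from `H Hᵀ = Hᵀ H = 668 I`) and records the sharpened summary
**`hadamard668_signedAut_prime_mem'`**: `p ∈ {2, 3, 5, 7, 11, 13, 23, 37, 41, 83, 167}`.  What is NOT claimed: that any of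
these eleven primes is excluded (`2`, `167` occur in the structured families; `3, …, 83` survive every test of the census).
Ours, not literature; no `sorry`.
-/

open Finset BigOperators Matrix

namespace Summit.Ventures.DiscreteObjects.Hadamard

open Literature.Combinatorics.Designs.GoethalsSeidel (IsHadamardMatrix)

variable {ι : Type*} [Fintype ι] [DecidableEq ι]

section transfer
variable {H : Matrix ι ι ℤ} {r c : ι}

/-- **Transfer for `p = 29` (fixed row and column given).**  A Hadamard matrix of order `668` has no signed automorphism with
`π^29 = κ^29 = 1`, `π ≠ 1`, `π r = r`, `κ c = c`. -/
theorem no_hadamard668_signedAut_29_of_fixed (hH : IsHadamardMatrix H) (hι : Fintype.card ι = 668)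
    (π κ : Equiv.Perm ι) (d e : ι → ℤ) (haut : IsSignedAut H π κ d e)
    (hπ : π ^ 29 = 1) (hκ : κ ^ 29 = 1) (hne : π ≠ 1) (hr : π r = r) (hc : κ c = c) : False := by
  -- the incidence function on the subtypes
  let N : {i // i ≠ r} → {j // j ≠ c} → ℤ := fun x y => inc H r c x.1 y.1
  have h01 : ∀ x y, N x y = 0 ∨ N x y = 1 := fun x y => inc_01 x.1 y.1
  have hrow : ∀ x, ∑ y, N x y = 333 := by
    intro x
    show ∑ y : {j // j ≠ c}, inc H r c x.1 y.1 = 333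
    rw [sum_subtype_ne (fun j => inc H r c x.1 j) c, inc_rowsum_full hH hι x.2, inc_col hH]
    norm_num
  have hpair : ∀ x x', x ≠ x' → ∑ y, N x y * N x' y = 166 := by
    intro x x' hxx'
    have hne' : x.1 ≠ x'.1 := fun h => hxx' (Subtype.ext h)
    show ∑ y : {j // j ≠ c}, inc H r c x.1 y.1 * inc H r c x'.1 y.1 = 166
    rw [sum_subtype_ne (fun j => inc H r c x.1 j * inc H r c x'.1 j) c, inc_pair_full hH hι x.2 x'.2 hne',
      inc_col hH, inc_col hH]
    norm_num
  have hcol : ∀ y, ∑ x, N x y = 333 := by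
    intro y
    show ∑ x : {i // i ≠ r}, inc H r c x.1 y.1 = 333
    rw [sum_subtype_ne (fun i => inc H r c i y.1) r, inc_colsum_full hH hι y.2]
    have : inc H r c r y.1 = 1 := by unfold inc; rw [if_pos (nrm_row hH y.1)]
    rw [this]; norm_num
  have hcpair : ∀ y y', y ≠ y' → ∑ x, N x y * N x y' = 166 := by
    intro y y' hyy'
    have hne' : y.1 ≠ y'.1 := fun h => hyy' (Subtype.ext h)
    show ∑ x : {i // i ≠ r}, inc H r c x.1 y.1 * inc H r c x.1 y'.1 = 166
    rw [sum_subtype_ne (fun i => inc H r c i y.1 * inc H r c i y'.1) r, inc_cpair_full hH hι y.2 y'.2 hne']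
    have e1 : inc H r c r y.1 = 1 := by unfold inc; rw [if_pos (nrm_row hH y.1)]
    have e2 : inc H r c r y'.1 = 1 := by unfold inc; rw [if_pos (nrm_row hH y'.1)]
    rw [e1, e2]; norm_num
  have hP : Fintype.card {i // i ≠ r} = 667 := by rw [card_subtype_ne', hι]
  have hB : Fintype.card {j // j ≠ c} = 667 := by rw [card_subtype_ne', hι]
  -- the induced permutations
  have hπr : ∀ i, π i ≠ r ↔ i ≠ r := by
    intro i
    constructor
    · intro h hi; exact h (by rw [hi, hr])
    · intro h hi; exact h (π.injective (by rw [hi, hr]))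
  have hκc : ∀ j, κ j ≠ c ↔ j ≠ c := by
    intro j
    constructor
    · intro h hj; exact h (by rw [hj, hc])
    · intro h hj; exact h (κ.injective (by rw [hj, hc]))
  let ρ : Equiv.Perm {i // i ≠ r} := π.subtypePerm hπr
  let τ : Equiv.Perm {j // j ≠ c} := κ.subtypePerm hκc
  have hN : ∀ x y, N (ρ x) (τ y) = N x y := by
    intro x y
    show inc H r c (π x.1) (κ y.1) = inc H r c x.1 y.1
    exact inc_aut haut hr hc x.1 y.1
  have hρ : ρ ^ 29 = 1 := by
    ext x
    simp [ρ, Equiv.Perm.subtypePerm_pow, hπ]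
  have hτ : τ ^ 29 = 1 := by
    ext y
    simp [τ, Equiv.Perm.subtypePerm_pow, hκ]
  -- a moved point
  obtain ⟨i₀, hi₀⟩ : ∃ i, π i ≠ i := by
    by_contra h
    exact hne (Equiv.ext fun i => not_not.mp (not_exists.mp h i))
  have hi₀r : i₀ ≠ r := fun h => hi₀ (by rw [h, hr])
  have hx₀ : ρ ⟨i₀, hi₀r⟩ ≠ ⟨i₀, hi₀r⟩ := by
    intro h
    apply hi₀
    have := congrArg Subtype.val h
    simpa [ρ] using this
  exact no_automorphism_29 N h01 hrow hpair hcol hcpair hP hB ρ τ hN hρ hτ ⟨i₀, hi₀r⟩ hx₀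

/-- **No Hadamard matrix of order 668 has a nontrivial signed automorphism `(π, κ, d, e)` with `π^29 = κ^29 = 1`.** -/
theorem no_hadamard668_signedAut_29 (hH : IsHadamardMatrix H) (hι : Fintype.card ι = 668)
    (π κ : Equiv.Perm ι) (d e : ι → ℤ) (haut : IsSignedAut H π κ d e)
    (hπ : π ^ 29 = 1) (hκ : κ ^ 29 = 1) (hne : π ≠ 1 ∨ κ ≠ 1) : False := by
  have hcard : (Fintype.card ι : ℤ) ≠ 0 := by rw [hι]; norm_num
  have hp : (29 : ℕ).Prime := by norm_num
  have hodd : Odd 29 := by decide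
  have hnd : ¬ 29 ∣ Fintype.card ι := by rw [hι]; norm_num
  have hπ1 : π ≠ 1 := by
    rcases hne with h | h
    · exact h
    · intro hπ1
      apply h
      rw [hπ1] at haut
      exact signedAut_snd_eq_one H hH hcard haut hodd hκ
  haveI : Fact (29 : ℕ).Prime := ⟨hp⟩
  obtain ⟨r, hr⟩ := Equiv.Perm.exists_fixed_point_of_prime (n := 1) hnd (σ := π) (by rw [pow_one]; exact hπ)
  obtain ⟨c, hc⟩ := Equiv.Perm.exists_fixed_point_of_prime (n := 1) hnd (σ := κ) (by rw [pow_one]; exact hκ)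
  exact no_hadamard668_signedAut_29_of_fixed hH hι π κ d e haut hπ hκ hπ1 hr hc

end transfer

/-- **Summary (kernel, no paper step).** The prime orders available to signed-permutation automorphisms of a Hadamard matrix
of order `668` lie in `{2, 3, 5, 7, 11, 13, 23, 37, 41, 83, 167}`. -/
theorem hadamard668_signedAut_prime_mem' {H : Matrix ι ι ℤ} (hH : IsHadamardMatrix H) (hι : Fintype.card ι = 668)
    (p : ℕ) (hp : p.Prime) (π κ : Equiv.Perm ι) (d e : ι → ℤ) (haut : IsSignedAut H π κ d e)
    (hπ : π ^ p = 1) (hκ : κ ^ p = 1) (hne : π ≠ 1 ∨ κ ≠ 1) :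
    p ∈ ({2, 3, 5, 7, 11, 13, 23, 37, 41, 83, 167} : Finset ℕ) := by
  have hmem := hadamard668_signedAut_prime_mem hH hι p hp π κ d e haut hπ hκ hne
  by_cases h29 : p = 29
  · subst h29
    exact (no_hadamard668_signedAut_29 hH hι π κ d e haut hπ hκ hne).elim
  · simp only [spectrum668, Finset.mem_insert, Finset.mem_singleton] at hmem ⊢
    omega

end Summit.Ventures.DiscreteObjects.Hadamard
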